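import Mathlib
import Summits.Ventures.PercRepro2.MixChordOPendantBlockConn

/-!
# The `o`-class `D`-chord with `a₃` in a PENDANT BLOCK AT `a₂` PLUS ONE EDGE TO `a₁`
(blind cell PercRepro2, night-1 g23; proofs/NIGHT1-G23.md §6)

The graph without the edge `e = {a₃, a₁}` has a cut vertex `v = a₂` with `a₃` alone (no other mark) on the
left side `L` — any graph, any weights there; `e` joins `a₃` to the other root.  The two-root star is the
case `L = {a₃}`.  The `o`-class `D`-chord along `f = {o, a₁}` follows from the root-edge closure under the
scaling property (`Star.dChord_of_update_zero_of_scales`):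

* `RightEvt W W'` — a «right event» of the full graph with its reading on the graph without `e`
  (connections among right vertices and their intersections);
* **`prob_update_one_eq_block`** / **`scales_block`**: the six `Q`-masses scale by
  `c = P(a₃ ↮ v by the edges other than e)` — with `e` open, `Q ∩ W` reads as `{a₃ ↮ v} ∩ ({a₁ ↮ v} ∩ W')`,
  the two factors depend on the left and on the right edges (independence,
  `prob_inter_eq_mul_of_dependsOn`), with `e` closed it reads as `{a₁ ↮ v} ∩ W'`;
* **`dChord_o_edge_of_pendant_block`** (the chord along `{o, a₁}`; the chord at `p[e ↦ 0]` is the cut-vertex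
  class in the support graph), the mirror **`dChord_o_edge₂_of_pendant_block`** (block at `a₁` plus one edge
  to `a₂`, along `{o, a₂}`), and the chain's rows `dz2Chord_o_edge_of_pendant_block` / `_o_edge₂_`.

Own code; standard axioms.
-/

namespace Summit.Ventures.PercRepro2

open UnionCluster CovForm

namespace Mix

namespace Block

open Support Star CutVertexM9

section Scaling

variable {V : Type*} {E : Type*} [Fintype E] [DecidableEq E] [DecidableEq V]
  {R : Type*} [Field R] [LinearOrder R] [IsStrictOrderedRing R]

variable (p : E → R) (ends : E → Sym2 V) (e : E) {a₁ a₃ v : V}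
  {side : {e' // e' ∈ others e} → Bool} {L : Set V} {Rt : Set V}

/-- A «right event» `W` of the full graph with its reading `W'` on the graph without `e`: the two agree
with `e` closed, and with `e` open whenever `a₃ ↮ v`; `W'` depends on the right edges only. -/
structure RightEvt (W : Set (Config E)) (W' : Set (Config {e' // e' ∈ others e})) : Prop where
  open_ : ∀ ω : Config E, ω e = true → ¬ Conn (restrictEnds (others e) ends) (res (others e) ω) a₃ v →
    (ω ∈ W ↔ res (others e) ω ∈ W')
  closed : ∀ ω : Config E, ω e = false → (ω ∈ W ↔ res (others e) ω ∈ W')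
  dep : DependsOn (· ∈ W') {e' | side e' = false}

variable {p ends e}

omit [DecidableEq V] [Field R] [LinearOrder R] [IsStrictOrderedRing R] in
/-- Right events are closed under intersection. -/
lemma RightEvt.inter {W₁ W₂ : Set (Config E)} {W₁' W₂' : Set (Config {e' // e' ∈ others e})}
    (h₁ : RightEvt ends e (a₃ := a₃) (v := v) (side := side) W₁ W₁')
    (h₂ : RightEvt ends e (a₃ := a₃) (v := v) (side := side) W₂ W₂') :
    RightEvt ends e (a₃ := a₃) (v := v) (side := side) (W₁ ∩ W₂) (W₁' ∩ W₂') where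
  open_ := fun ω hω hno => by
    simp only [Set.mem_inter_iff, h₁.open_ ω hω hno, h₂.open_ ω hω hno]
  closed := fun ω hω => by
    simp only [Set.mem_inter_iff, h₁.closed ω hω, h₂.closed ω hω]
  dep := by
    have := dependsOn_inter h₁.dep h₂.dep
    rwa [Set.union_self] at this

omit [DecidableEq V] [Field R] [LinearOrder R] [IsStrictOrderedRing R] in
/-- The trivial right event. -/
lemma rightEvt_univ : RightEvt ends e (a₃ := a₃) (v := v) (side := side) Set.univ Set.univ where
  open_ := fun _ _ _ => by simp
  closed := fun _ _ => by simp
  dep := fun _ _ _ => rfl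

omit [DecidableEq V] [Field R] [LinearOrder R] [IsStrictOrderedRing R] in
/-- A connection between two right vertices is a right event. -/
lemma rightEvt_connEvent (h : CutVertex (restrictEnds (others e) ends) side L v Rt)
    (he : ends e = s(a₃, a₁)) (h3 : a₃ ∈ L) {x y : V} (hx : x ∈ Rt ∨ x = v) (hy : y ∈ Rt ∨ y = v) :
    RightEvt ends e (a₃ := a₃) (v := v) (side := side) (connEvent ends x y)
      (connEvent (restrictEnds (others e) ends) x y) where
  open_ := fun ω hω hno => by
    simp only [mem_connEvent]
    exact conn_right_iff_open ends e h he h3 hω hno hx hy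
  closed := fun ω hω => by
    simp only [mem_connEvent]
    exact conn_iff_closed ends e hω x y
  dep := fun ω ω' hag => by
    simp only [mem_connEvent]
    exact propext (conn_right_congr h hx hy fun e' he' => hag e' he')

omit [DecidableEq V] [Field R] [LinearOrder R] [IsStrictOrderedRing R] in
/-- `Q ∩ W` read on the graph without `e`: with `e` open it is `{a₃ ↮ v} ∩ ({a₁ ↮ v} ∩ W')`. -/
lemma mem_Q_inter_iff_open (he : ends e = s(a₃, a₁))
    {W : Set (Config E)} {W' : Set (Config {e' // e' ∈ others e})}
    (hW : RightEvt ends e (a₃ := a₃) (v := v) (side := side) W W') {ω : Config E} (hω : ω e = true) :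
    ω ∈ avoidAll ends v {a₁} ∩ W ↔
      res (others e) ω ∈ {ω' | ¬ Conn (restrictEnds (others e) ends) ω' a₃ v} ∩
        ({ω' | ¬ Conn (restrictEnds (others e) ends) ω' a₁ v} ∩ W') := by
  rw [Set.mem_inter_iff, Q_iff_open ends e he hω]
  simp only [Set.mem_inter_iff, Set.mem_setOf_eq]
  constructor
  · rintro ⟨⟨hc1, hc3⟩, hw⟩
    exact ⟨hc3, hc1, (hW.open_ ω hω hc3).1 hw⟩
  · rintro ⟨hc3, hc1, hw⟩
    exact ⟨⟨hc1, hc3⟩, (hW.open_ ω hω hc3).2 hw⟩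

omit [DecidableEq V] [Field R] [LinearOrder R] [IsStrictOrderedRing R] in
/-- `Q ∩ W` read on the graph without `e`, with `e` closed. -/
lemma mem_Q_inter_iff_closed {W : Set (Config E)} {W' : Set (Config {e' // e' ∈ others e})}
    (hW : RightEvt ends e (a₃ := a₃) (v := v) (side := side) W W') {ω : Config E} (hω : ω e = false) :
    ω ∈ avoidAll ends v {a₁} ∩ W ↔
      res (others e) ω ∈ {ω' | ¬ Conn (restrictEnds (others e) ends) ω' a₁ v} ∩ W' := by
  simp only [Set.mem_inter_iff, avoidAll, Set.mem_setOf_eq, Finset.mem_singleton, forall_eq,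
    hW.closed ω hω, conn_iff_closed ends e hω]
  constructor
  · rintro ⟨hc, hw⟩; exact ⟨fun h' => hc (conn_symm h'), hw⟩
  · rintro ⟨hc, hw⟩; exact ⟨fun h' => hc (conn_symm h'), hw⟩

omit [DecidableEq V] [LinearOrder R] [IsStrictOrderedRing R] in
/-- The weights of `p[e ↦ 0]` vanish off the other edges. -/
lemma update_zero_off_others : ∀ e', e' ∉ others e → Function.update p e 0 e' = 0 := by
  intro e' he'
  have : e' = e := by
    by_contra hne
    exact he' (mem_others_of_ne e hne)
  subst this
  simp

omit [DecidableEq V] in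
/-- A probability read through `res` under a pin of `e` is the restricted probability. -/
lemma prob_res (c : R) (C : Set (Config {e' // e' ∈ others e})) :
    prob (Function.update p e c) {ω | res (others e) ω ∈ C} = prob (Support.restrict (others e) p) C := by
  have hfree := free_of_res (others e) (e_not_mem_others e) C
  have h1 : prob (Function.update p e c) {ω | res (others e) ω ∈ C} =
      prob (Function.update (Function.update p e c) e 0) {ω | res (others e) ω ∈ C} :=
    (prob_update_zero_eq_of_free _ hfree).symm
  rw [h1, Function.update_idem, prob_restrict _ (update_zero_off_others (p := p) (e := e)),
    Star.restrict_update_of_not_mem _ _ (e_not_mem_others e)]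
  congr 1
  ext ω'
  simp only [Set.mem_preimage, Set.mem_setOf_eq, res_ext]

omit [DecidableEq V] in
/-- **The scaling identity of a pendant block**: for a right event `W`,
`P_{p[e ↦ 1]}(Q ∩ W) = P_{p|others}(a₃ ↮ v)·P_{p[e ↦ 0]}(Q ∩ W)`. -/
theorem prob_update_one_eq_block (h : CutVertex (restrictEnds (others e) ends) side L v Rt)
    (he : ends e = s(a₃, a₁)) (h3 : a₃ ∈ L) (h1 : a₁ ∈ Rt ∨ a₁ = v)
    {W : Set (Config E)} {W' : Set (Config {e' // e' ∈ others e})}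
    (hW : RightEvt ends e (a₃ := a₃) (v := v) (side := side) W W') :
    prob (Function.update p e 1) (avoidAll ends v {a₁} ∩ W) =
      prob (Support.restrict (others e) p) {ω' | ¬ Conn (restrictEnds (others e) ends) ω' a₃ v} *
        prob (Function.update p e 0) (avoidAll ends v {a₁} ∩ W) := by
  classical
  set A : Set (Config {e' // e' ∈ others e}) := {ω' | ¬ Conn (restrictEnds (others e) ends) ω' a₃ v}
  set B : Set (Config {e' // e' ∈ others e}) :=
    {ω' | ¬ Conn (restrictEnds (others e) ends) ω' a₁ v} ∩ W'
  -- the open side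
  have hopen : prob (Function.update p e 1) (avoidAll ends v {a₁} ∩ W) =
      prob (Support.restrict (others e) p) (A ∩ B) := by
    rw [← prob_update_one_inter_openEdge]
    have : (avoidAll ends v {a₁} ∩ W) ∩ openEdge e = {ω | res (others e) ω ∈ A ∩ B} ∩ openEdge e := by
      ext ω
      simp only [Set.mem_inter_iff, mem_openEdge, Set.mem_setOf_eq]
      constructor
      · rintro ⟨hQ, hω⟩
        exact ⟨(mem_Q_inter_iff_open he hW hω).1 hQ, hω⟩
      · rintro ⟨hQ, hω⟩
        exact ⟨(mem_Q_inter_iff_open he hW hω).2 hQ, hω⟩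
    rw [this, prob_update_one_inter_openEdge, prob_res]
  -- the closed side
  have hclosed : prob (Function.update p e 0) (avoidAll ends v {a₁} ∩ W) = prob (Support.restrict (others e) p) B := by
    rw [← prob_update_zero_inter_closedEdge]
    have : (avoidAll ends v {a₁} ∩ W) ∩ closedEdge e = {ω | res (others e) ω ∈ B} ∩ closedEdge e := by
      ext ω
      simp only [Set.mem_inter_iff, mem_closedEdge, Set.mem_setOf_eq]
      constructor
      · rintro ⟨hQ, hω⟩
        exact ⟨(mem_Q_inter_iff_closed hW hω).1 hQ, hω⟩
      · rintro ⟨hQ, hω⟩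
        exact ⟨(mem_Q_inter_iff_closed hW hω).2 hQ, hω⟩
    rw [this, prob_update_zero_inter_closedEdge, prob_res]
  -- independence of the two sides
  have hA : DependsOn (· ∈ A) {e' | side e' = true} := by
    intro ω ω' hag
    simp only [A, Set.mem_setOf_eq]
    exact propext (not_congr (conn_left_congr h (Or.inl h3) (Or.inr rfl) fun e' he' => hag e' he'))
  have hB : DependsOn (· ∈ B) {e' | side e' = false} := by
    have h1' : DependsOn (· ∈ {ω' : Config {e' // e' ∈ others e} |
        ¬ Conn (restrictEnds (others e) ends) ω' a₁ v}) {e' | side e' = false} := by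
      intro ω ω' hag
      simp only [Set.mem_setOf_eq]
      exact propext (not_congr (conn_right_congr h h1 (Or.inr rfl) fun e' he' => hag e' he'))
    have := dependsOn_inter h1' hW.dep
    rwa [Set.union_self] at this
  have hdisj : Disjoint {e' : {e' // e' ∈ others e} | side e' = true} {e' | side e' = false} := by
    rw [Set.disjoint_left]
    intro e' h1 h2
    simp only [Set.mem_setOf_eq] at h1 h2
    simp [h1] at h2
  rw [hopen, hclosed, prob_inter_eq_mul_of_dependsOn _ hdisj hA hB]

end Scaling

section Theorem

variable {V : Type*} {E : Type*} [Fintype E] [DecidableEq E] [Fintype V] [DecidableEq V]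
  {R : Type*} [Field R] [LinearOrder R] [IsStrictOrderedRing R]

variable (p : E → R) (ends : E → Sym2 V) {o a₁ a₃ v : V} (b : V) {e f : E}
  {side : {e' // e' ∈ others e} → Bool} {L : Set V} {Rt : Set V}

omit [Fintype V] [DecidableEq V] in
/-- The `Q`-masses of the root-edge closure scale on a pendant block. -/
theorem scales_block (h : CutVertex (restrictEnds (others e) ends) side L v Rt)
    (he : ends e = s(a₃, a₁)) (h3 : a₃ ∈ L) (ho : o ∈ Rt ∨ o = v) (h1 : a₁ ∈ Rt ∨ a₁ = v)
    (hb : b ∈ Rt ∨ b = v) :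
    Scales p ends o a₁ v b e (prob (Support.restrict (others e) p)
      {ω' | ¬ Conn (restrictEnds (others e) ends) ω' a₃ v}) := by
  have hv : v ∈ Rt ∨ v = v := Or.inr rfl
  have c : ∀ {x y : V}, x ∈ Rt ∨ x = v → y ∈ Rt ∨ y = v →
      RightEvt ends e (a₃ := a₃) (v := v) (side := side) (connEvent ends x y)
        (connEvent (restrictEnds (others e) ends) x y) :=
    fun hx hy => rightEvt_connEvent h he h3 hx hy
  refine ⟨?_, ?_, ?_, ?_, ?_, ?_⟩
  · have := prob_update_one_eq_block (p := p) h he h3 h1 rightEvt_univ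
    simpa using this
  · exact prob_update_one_eq_block (p := p) h he h3 h1 (c hv ho)
  · exact prob_update_one_eq_block (p := p) h he h3 h1 (c h1 hb)
  · exact prob_update_one_eq_block (p := p) h he h3 h1 (c hv hb)
  · exact prob_update_one_eq_block (p := p) h he h3 h1 ((c hv ho).inter (c h1 hb))
  · exact prob_update_one_eq_block (p := p) h he h3 h1 ((c hv ho).inter (c hv hb))

/-- **THE `o`-CLASS `D`-CHORD WITH `a₃` IN A PENDANT BLOCK AT `a₂` PLUS ONE EDGE TO `a₁`**: the graph without
`e = {a₃, a₁}` has the cut vertex `v = a₂` with `a₃` alone on its left side (any graph, any weights there);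
the chord along `f = {o, a₁}`. -/
theorem dChord_o_edge_of_pendant_block (h : CutVertex (restrictEnds (others e) ends) side L v Rt)
    (hp : IsProbVec p) (he : ends e = s(a₃, a₁)) (h3 : a₃ ∈ L) (ho : o ∈ Rt ∨ o = v)
    (h1 : a₁ ∈ Rt ∨ a₁ = v) (hb : b ∈ Rt ∨ b = v) (hf : ends f = s(o, a₁)) (ho1 : o ≠ a₁) :
    NMixChord (normD ends a₁ v a₃) p ends o a₁ v a₃ b f := by
  have h3v : a₃ ≠ v := fun h' => h.vL (h' ▸ h3)
  have ho3 : o ≠ a₃ := by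
    rintro rfl
    rcases ho with ho | ho
    · exact h.disj _ h3 ho
    · exact h3v ho
  have h31 : a₃ ≠ a₁ := by
    rintro rfl
    rcases h1 with h1 | h1
    · exact h.disj _ h3 h1
    · exact h3v h1
  have hef : e ≠ f := root_ne_o_edge ends hf he ho3 h31
  have hfS : f ∈ others e := mem_others_of_ne e hef.symm
  have hends : ends e = s(a₁, a₃) := by rw [he, Sym2.eq_swap]
  -- the scaling factor is the same at `p[f ↦ 0]`: `f` is a right edge
  have hfside : side ⟨f, hfS⟩ = false :=
    side_eq_false_of_right h (f := ⟨f, hfS⟩) (x := o) (y := a₁) hf ho h1 ho1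
  have hc : prob (Support.restrict (others e) (Function.update p f 0))
        {ω' | ¬ Conn (restrictEnds (others e) ends) ω' a₃ v} =
      prob (Support.restrict (others e) p) {ω' | ¬ Conn (restrictEnds (others e) ends) ω' a₃ v} := by
    rw [Support.restrict_update _ _ hfS]
    refine prob_update_zero_eq_of_free _ ?_
    intro ω ω' hag
    simp only [Set.mem_setOf_eq]
    refine propext (not_congr (conn_left_congr h (Or.inl h3) (Or.inr rfl) fun e' he' => hag e' ?_))
    rintro rfl
    rw [hfside] at he'
    exact Bool.false_ne_true he'
  have hs0 := scales_block (Function.update p f 0) ends b h he h3 ho h1 hb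
  rw [hc] at hs0
  refine dChord_of_update_zero_of_scales hp hends hf hef
    (prob_nonneg (isProbVec_restrict p _ hp) _) (scales_block p ends b h he h3 ho h1 hb) hs0 ?_
  -- the chord at `p[e ↦ 0]`: `a₃` alone behind the cut vertex `v = a₂` in the support graph
  exact dChord_o_edge_a3_behind_a2_support (others e) (update_zero_off_others (p := p) (e := e))
    ends h (hp.update e le_rfl zero_le_one) h3 ho h1 hb hfS hf ho1

/-- **The chain's row with `a₃` in a pendant block at `a₂` plus one edge to `a₁`.** -/
theorem dz2Chord_o_edge_of_pendant_block (h : CutVertex (restrictEnds (others e) ends) side L v Rt)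
    (hp : IsProbVec p) (he : ends e = s(a₃, a₁)) (h3 : a₃ ∈ L) (ho : o ∈ Rt ∨ o = v)
    (h1 : a₁ ∈ Rt ∨ a₁ = v) (hb : b ∈ Rt ∨ b = v) (hf : ends f = s(o, a₁)) (ho1 : o ≠ a₁)
    (h0 : HCov (Function.update p f 0) ends o a₁ v a₃ b) :
    NMixChord (normDZ2 ends a₁ v a₃) p ends o a₁ v a₃ b f :=
  nMixChord_DZ2_of_D hp (dChord_o_edge_of_pendant_block p ends b h hp he h3 ho h1 hb hf ho1) h0

/-- **The mirror class along the other `o`-edge**: `a₃` in a pendant block at `a₁` plus one edge to `a₂`,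
the chord along `f = {o, a₂}` (root swap). -/
theorem dChord_o_edge₂_of_pendant_block {a₂ : V} (h : CutVertex (restrictEnds (others e) ends) side L v Rt)
    (hp : IsProbVec p) (he : ends e = s(a₃, a₂)) (h3 : a₃ ∈ L) (ho : o ∈ Rt ∨ o = v)
    (h2 : a₂ ∈ Rt ∨ a₂ = v) (hb : b ∈ Rt ∨ b = v) (hf : ends f = s(o, a₂)) (ho2 : o ≠ a₂) :
    NMixChord (normD ends v a₂ a₃) p ends o v a₂ a₃ b f :=
  (nMixChord_normD_root_swap p ends b o v a₂ a₃ f).1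
    (dChord_o_edge_of_pendant_block p ends b h hp he h3 ho h2 hb hf ho2)

/-- **The chain's row on the mirror class.** -/
theorem dz2Chord_o_edge₂_of_pendant_block {a₂ : V} (h : CutVertex (restrictEnds (others e) ends) side L v Rt)
    (hp : IsProbVec p) (he : ends e = s(a₃, a₂)) (h3 : a₃ ∈ L) (ho : o ∈ Rt ∨ o = v)
    (h2 : a₂ ∈ Rt ∨ a₂ = v) (hb : b ∈ Rt ∨ b = v) (hf : ends f = s(o, a₂)) (ho2 : o ≠ a₂)
    (h0 : HCov (Function.update p f 0) ends o v a₂ a₃ b) :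
    NMixChord (normDZ2 ends v a₂ a₃) p ends o v a₂ a₃ b f :=
  nMixChord_DZ2_of_D hp (dChord_o_edge₂_of_pendant_block p ends b h hp he h3 ho h2 hb hf ho2) h0

end Theorem

end Block

end Mix

end Summit.Ventures.PercRepro2
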